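import Summits.Langlands.Langlands.Theorems.RamifiedCoefficientSeedAdjointLiftingGL3StubEnormousAdPrelim
import Literature.NumberTheory.GaloisRepresentations.ExtendedAdequateSubgroup
import HarnessLib

/-!
# Route `RamifiedCoefficientSeed`, crux `AdjointLiftingGL3` (stmt-Langlands-16779), line `birth`:
# stub `stub_enormousAd`, part II — "enormous only depends on the image in `PGL_n(k)`"

ACC+ (Allen–Calegari–Caraiani–Gee–Helm–Le Hung–Newton–Scholze–Taylor–Thorne, *Potential
automorphy over CM fields*, Ann. of Math. 197 (2023)), remark after Def. 6.2.28: "Note that this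
only depends on the image of `H` in `PGL_n(k)`" (there `k` is "any algebraic extension of `𝔽_p`",
§6.2.9).  This file PROVES it for the tree's structure `Subgroup.IsEnormous`
(`Literature/NumberTheory/GaloisRepresentations/EnormousSubgroup`), in the form consumed by stub
`stub_enormousAd` and in its literal form:

* `isEnormous_of_forall_exists_eq_scalar_mul_conj` — let `H, H' ≤ GL_n(k)` and `g ∈ GL_n(k)` be such
  that `H` and `g H' g⁻¹` have the same image in `PGL_n(k)` (elementwise: every `x ∈ H` is
  `c · g h' g⁻¹` for some `h' ∈ H'` and scalar `c`, and every `h' ∈ H'` so arises); assume `k` has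
  characteristic `p` and every unit of `k` has finite order prime to `p` (automatic when `k` is
  algebraic over `𝔽_p`, part I).  Then `H'` enormous ⇒ `H` enormous.
* `isEnormous_iff_of_map_mk_eq` — the literal remark: `H.map mk = H'.map mk → (H` enormous `↔ H'`
  enormous`)`.  (The hypothesis on `k` is needed: over `k = 𝔽̄_p(T)` the group `H' · ⟨T · 1⟩` has
  the quotient `ℤ/p` for every finite enormous `H'`.)

Proof, clause by clause (scalars `Z = kˣ · 1` act trivially on `ad⁰`): (1) a quotient `H ↠ Q` of
order `p^a` kills `H ∩ Z` (orders prime to `p`), so `Q` is a quotient of the common projective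
image, hence of `H'` (`transfer_card_quotient`); (2a) `M ↦ g⁻¹ M g` carries `H`-invariants to
`H'`-invariants; (2b) a `1`-cocycle `f` of `H` vanishes on `H ∩ Z` (`f(s^m) = m f(s)`, `p ∤ m`),
hence factors through the projective image, and `h' ↦ g⁻¹ f(x_{h'}) g` is a `1`-cocycle of `H'`, a
coboundary by hypothesis, whence `f` is one (`transfer_cocycles₁`); (3) `W ↦ g⁻¹ W g` is an
isomorphism between the lattices of sub-`k[H]`- and sub-`k[H']`-modules of `ad⁰` (`subrepEquiv`),
and regular semisimplicity is invariant under scalars and conjugation (part I).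

References: [ACCGHLNSTT2023] Def. 6.2.28 and the remark following it (held: arXiv:1812.09999,
§6.2.9, Definition 90).
-/

set_option linter.dupNamespace false

noncomputable section

namespace Summit.Langlands.Langlands.Cruxes.AdjointLiftingGL3.Birth

open scoped MatrixGroups
open Literature.NumberTheory.GaloisRepresentations Matrix

variable {k : Type*} [Field k] {n : ℕ}


/-! ## Transfer of the four clauses of `IsEnormous` -/

section Transfer

variable {p : ℕ} [Fact p.Prime] [CharP k p]
variable {H H' : Subgroup (GL (Fin n) k)} {g : GL (Fin n) k}

omit [CharP k p] in
/-- A scalar of finite order prime to `p` lying in `H` dies in every quotient of `H` of `p`-power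
order. [folklore] -/
theorem mk_scalar_eq_one (htor : ∀ a : kˣ, ∃ m : ℕ, ¬ p ∣ m ∧ a ^ m = 1) (N : Subgroup H) [N.Normal]
    {a : ℕ} (hN : Nat.card (H ⧸ N) = p ^ a) {c : kˣ}
    (hc : GeneralLinearGroup.scalar (Fin n) c ∈ H) :
    (QuotientGroup.mk ⟨GeneralLinearGroup.scalar (Fin n) c, hc⟩ : H ⧸ N) = 1 := by
  obtain ⟨m, hpm, hcm⟩ := htor c
  set s : H := ⟨GeneralLinearGroup.scalar (Fin n) c, hc⟩ with hsdef
  have hsm : s ^ m = 1 := by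
    apply Subtype.ext
    rw [SubmonoidClass.coe_pow, OneMemClass.coe_one]
    change GeneralLinearGroup.scalar (Fin n) c ^ m = 1
    rw [← map_pow, hcm, map_one]
  have h1 : (QuotientGroup.mk s : H ⧸ N) ^ m = 1 := by
    rw [← QuotientGroup.mk_pow, hsm, QuotientGroup.mk_one]
  have h2 : (QuotientGroup.mk s : H ⧸ N) ^ (p ^ a) = 1 := by
    rw [← hN]; exact pow_card_eq_one'
  have hcop : Nat.Coprime m (p ^ a) :=
    (Nat.Coprime.pow_right a ((Nat.Prime.coprime_iff_not_dvd Fact.out).mpr hpm).symm)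
  have hd : orderOf (QuotientGroup.mk s : H ⧸ N) ∣ Nat.gcd m (p ^ a) :=
    Nat.dvd_gcd (orderOf_dvd_of_pow_eq_one h1) (orderOf_dvd_of_pow_eq_one h2)
  rw [hcop.gcd_eq_one, Nat.dvd_one] at hd
  exact orderOf_eq_one_iff.mp hd

/-- **Clause (1) transfers**: if `H` and `g H' g⁻¹` have the same projective image and `H'` has no
non-trivial quotient of `p`-power order, neither has `H` (a quotient `H ↠ Q` of `p`-power order
kills the scalars of `H`, so factors through the projective image, onto which `H'` surjects).
[cite: ACCGHLNSTT2023, Def. 6.2.28 (remark: "only depends on the image of H in PGL_n(k)")] -/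
theorem transfer_card_quotient (htor : ∀ a : kˣ, ∃ m : ℕ, ¬ p ∣ m ∧ a ^ m = 1)
    (h₁ : ∀ x ∈ H, ∃ h' ∈ H', ∃ c : kˣ, x = GeneralLinearGroup.scalar (Fin n) c * g * h' * g⁻¹)
    (h₂ : ∀ h' ∈ H', ∃ x ∈ H, ∃ c : kˣ, x = GeneralLinearGroup.scalar (Fin n) c * g * h' * g⁻¹)
    (hH' : Subgroup.IsEnormous H') (N : Subgroup H) [N.Normal] (a : ℕ)
    (hN : Nat.card (H ⧸ N) = ringChar k ^ a) : a = 0 := by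
  classical
  rw [ringChar.eq k p] at hN
  choose L hL c hc using h₂
  -- any element of `H` over `h'` has the same image in `H ⧸ N` as the chosen lift `L h'`
  have hkey : ∀ (h' : H') (x : GL (Fin n) k) (hx : x ∈ H) (d : kˣ),
      x = GeneralLinearGroup.scalar (Fin n) d * g * h' * g⁻¹ →
        (QuotientGroup.mk ⟨x, hx⟩ : H ⧸ N) = QuotientGroup.mk ⟨L h' h'.2, hL h' h'.2⟩ := by
    intro h' x hx d hxd
    obtain ⟨e, he, hxe⟩ := exists_scalar_mem_of_eq hxd (hc h' h'.2) hx (hL h' h'.2)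
    have hx' : (⟨x, hx⟩ : H) =
        ⟨GeneralLinearGroup.scalar (Fin n) e, he⟩ * ⟨L h' h'.2, hL h' h'.2⟩ := Subtype.ext hxe
    rw [hx', QuotientGroup.mk_mul, mk_scalar_eq_one htor N hN he, one_mul]
  let ψ : H' →* H ⧸ N :=
    { toFun := fun h' => QuotientGroup.mk ⟨L h' h'.2, hL h' h'.2⟩
      map_one' := by
        have h := hkey 1 1 H.one_mem 1 (by rw [map_one, one_mul, OneMemClass.coe_one, mul_one,
          mul_inv_cancel])
        rw [← h]
        rfl
      map_mul' := fun a b => by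
        have hmem : L a a.2 * L b b.2 ∈ H := H.mul_mem (hL a a.2) (hL b b.2)
        have h := hkey (a * b) _ hmem _ (lift_mul_eq (hc a a.2) (hc b b.2))
        rw [← h]
        rfl }
  have hsurj : Function.Surjective ψ := by
    intro q
    obtain ⟨⟨x, hx⟩, rfl⟩ := QuotientGroup.mk_surjective q
    obtain ⟨h', hh', d, hxd⟩ := h₁ x hx
    exact ⟨⟨h', hh'⟩, (hkey ⟨h', hh'⟩ x hx d hxd).symm⟩
  have hcard : Nat.card (H' ⧸ ψ.ker) = ringChar k ^ a := by
    rw [Nat.card_congr (QuotientGroup.quotientKerEquivOfSurjective ψ hsurj).toEquiv, hN,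
      ringChar.eq k p]
  exact hH'.eq_zero_of_card_quotient ψ.ker a hcard

/-- **Clause (2a) transfers**: `M ↦ g⁻¹ M g` carries `H`-invariants of `ad⁰` to `H'`-invariants.
[cite: ACCGHLNSTT2023, Def. 6.2.28 (remark: "only depends on the image of H in PGL_n(k)")] -/
theorem transfer_invariants
    (h₂ : ∀ h' ∈ H', ∃ x ∈ H, ∃ c : kˣ, x = GeneralLinearGroup.scalar (Fin n) c * g * h' * g⁻¹)
    (hH' : Subgroup.IsEnormous H') : (Subgroup.adZeroRep H).invariants = ⊥ := by
  rw [eq_bot_iff]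
  intro M hM
  rw [Representation.mem_invariants] at hM
  rw [Submodule.mem_bot]
  have hM' : (adZero (Fin n) k).toRepresentation g⁻¹ M ∈ (Subgroup.adZeroRep H').invariants := by
    rw [Representation.mem_invariants]
    intro h'
    obtain ⟨x, hx, c, hxc⟩ := h₂ h' h'.2
    have h3 := LinearMap.congr_fun (adGL_eq_of_eq_scalar_mul_conj hxc) M
    have h4 : (adZero (Fin n) k).toRepresentation x M = M := hM ⟨x, hx⟩
    rw [h4, Module.End.mul_apply, Module.End.mul_apply] at h3
    rw [adZeroRep_apply]
    have h5 := congrArg ((adZero (Fin n) k).toRepresentation g⁻¹) h3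
    rw [adGL_inv_apply_self] at h5
    exact h5.symm
  rw [hH'.invariants_eq_bot, Submodule.mem_bot] at hM'
  have h6 := congrArg ((adZero (Fin n) k).toRepresentation g) hM'
  rwa [adGL_apply_inv_self, map_zero] at h6

/-- A `1`-cocycle vanishes at `1`. [folklore] -/
theorem cocycle_apply_one {f : H → (adZero (Fin n) k).toSubmodule}
    (hf : ∀ x y : H,
      f (x * y) = (adZero (Fin n) k).toRepresentation (x : GL (Fin n) k) (f y) + f x) :
    f 1 = 0 := by
  have h := hf 1 1
  rw [mul_one, OneMemClass.coe_one, map_one, Module.End.one_apply] at h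
  exact add_eq_left.mp h.symm

omit [Fact p.Prime] in
/-- **A `1`-cocycle of `H` with values in `ad⁰` vanishes on the scalars of `H`**: on a scalar `s`
of order `m` prime to `p` (acting trivially) the cocycle identity gives `0 = f(s^m) = m · f(s)`.
[folklore] -/
theorem cocycle_apply_scalar_eq_zero (htor : ∀ a : kˣ, ∃ m : ℕ, ¬ p ∣ m ∧ a ^ m = 1)
    {f : H → (adZero (Fin n) k).toSubmodule}
    (hf : ∀ x y : H, f (x * y) = (adZero (Fin n) k).toRepresentation (x : GL (Fin n) k) (f y) + f x)
    {c : kˣ} (hc : GeneralLinearGroup.scalar (Fin n) c ∈ H) :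
    f ⟨GeneralLinearGroup.scalar (Fin n) c, hc⟩ = 0 := by
  set s : H := ⟨GeneralLinearGroup.scalar (Fin n) c, hc⟩ with hsdef
  have hs : ∀ j : ℕ, (adZero (Fin n) k).toRepresentation ((s ^ j : H) : GL (Fin n) k) = 1 := by
    intro j
    rw [SubmonoidClass.coe_pow, map_pow, hsdef, adGL_scalar, one_pow]
  have hpow : ∀ j : ℕ, f (s ^ j) = (j : k) • f s := by
    intro j
    induction j with
    | zero => rw [pow_zero, cocycle_apply_one hf, Nat.cast_zero, zero_smul]
    | succ j ih =>
      rw [pow_succ, hf, hs, Module.End.one_apply, ih, Nat.cast_succ, add_smul, one_smul, add_comm]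
  obtain ⟨m, hpm, hcm⟩ := htor c
  have hsm : s ^ m = 1 := by
    apply Subtype.ext
    rw [SubmonoidClass.coe_pow, OneMemClass.coe_one]
    change GeneralLinearGroup.scalar (Fin n) c ^ m = 1
    rw [← map_pow, hcm, map_one]
  have h := hpow m
  rw [hsm, cocycle_apply_one hf] at h
  have hm0 : (m : k) ≠ 0 := by
    intro h0
    rw [CharP.cast_eq_zero_iff k p] at h0
    exact hpm h0
  exact (smul_eq_zero.mp h.symm).resolve_left hm0

omit [Fact p.Prime] in
/-- **Clause (2b) transfers**: every `1`-cocycle of `H` in `ad⁰` is a `1`-coboundary as soon as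
this holds for `H'` (the cocycle factors through the common projective image).
[cite: ACCGHLNSTT2023, Def. 6.2.28 (remark: "only depends on the image of H in PGL_n(k)")] -/
theorem transfer_cocycles₁ (htor : ∀ a : kˣ, ∃ m : ℕ, ¬ p ∣ m ∧ a ^ m = 1)
    (h₁ : ∀ x ∈ H, ∃ h' ∈ H', ∃ c : kˣ, x = GeneralLinearGroup.scalar (Fin n) c * g * h' * g⁻¹)
    (h₂ : ∀ h' ∈ H', ∃ x ∈ H, ∃ c : kˣ, x = GeneralLinearGroup.scalar (Fin n) c * g * h' * g⁻¹)
    (hH' : Subgroup.IsEnormous H') :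
    groupCohomology.cocycles₁ (Rep.of (Subgroup.adZeroRep H)) ≤
      groupCohomology.coboundaries₁ (Rep.of (Subgroup.adZeroRep H)) := by
  classical
  rw [cocycles₁_le_coboundaries₁_iff_forall]
  intro f hf
  change ∀ x y : H, f (x * y) =
    (adZero (Fin n) k).toRepresentation (x : GL (Fin n) k) (f y) + f x at hf
  change ∃ m, ∀ x : H, f x = (adZero (Fin n) k).toRepresentation (x : GL (Fin n) k) m - m
  -- `f` is invariant under translation by scalars of `H`
  have hscal : ∀ (e : kˣ) (he : GeneralLinearGroup.scalar (Fin n) e ∈ H) (y : H),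
      f (⟨GeneralLinearGroup.scalar (Fin n) e, he⟩ * y) = f y := by
    intro e he y
    rw [hf, cocycle_apply_scalar_eq_zero htor hf he, add_zero]
    change (adZero (Fin n) k).toRepresentation (GeneralLinearGroup.scalar (Fin n) e) (f y) = f y
    rw [adGL_scalar, Module.End.one_apply]
  choose L hL c hc using h₂
  let f' : H' → (adZero (Fin n) k).toSubmodule := fun h' =>
    (adZero (Fin n) k).toRepresentation g⁻¹ (f ⟨L h' h'.2, hL h' h'.2⟩)
  -- any element of `H` over `h'` computes `f' h'`
  have hkey : ∀ (h' : H') (x : GL (Fin n) k) (hx : x ∈ H) (d : kˣ),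
      x = GeneralLinearGroup.scalar (Fin n) d * g * h' * g⁻¹ →
        (adZero (Fin n) k).toRepresentation g⁻¹ (f ⟨x, hx⟩) = f' h' := by
    intro h' x hx d hxd
    obtain ⟨e, he, hxe⟩ := exists_scalar_mem_of_eq hxd (hc h' h'.2) hx (hL h' h'.2)
    have hx' : (⟨x, hx⟩ : H) =
        ⟨GeneralLinearGroup.scalar (Fin n) e, he⟩ * ⟨L h' h'.2, hL h' h'.2⟩ := Subtype.ext hxe
    rw [hx', hscal]
  have hf' : ∀ a b : H',
      f' (a * b) = (adZero (Fin n) k).toRepresentation (a : GL (Fin n) k) (f' b) + f' a := by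
    intro a b
    have hmem : L a a.2 * L b b.2 ∈ H := H.mul_mem (hL a a.2) (hL b b.2)
    rw [← hkey (a * b) _ hmem _ (lift_mul_eq (hc a a.2) (hc b b.2))]
    have hab : (⟨L a a.2 * L b b.2, hmem⟩ : H) = ⟨L a a.2, hL a a.2⟩ * ⟨L b b.2, hL b b.2⟩ := rfl
    rw [hab, hf, map_add]
    change (adZero (Fin n) k).toRepresentation g⁻¹
        ((adZero (Fin n) k).toRepresentation (L a a.2) (f ⟨L b b.2, hL b b.2⟩)) + f' a =
      (adZero (Fin n) k).toRepresentation (a : GL (Fin n) k) (f' b) + f' a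
    rw [adGL_eq_of_eq_scalar_mul_conj (hc a a.2), Module.End.mul_apply, Module.End.mul_apply,
      adGL_inv_apply_self]
  obtain ⟨m', hm'⟩ := (cocycles₁_le_coboundaries₁_iff_forall (Rep.of (Subgroup.adZeroRep H'))).mp
    hH'.cocycles₁_le_coboundaries₁ f' hf'
  refine ⟨(adZero (Fin n) k).toRepresentation g m', fun x => ?_⟩
  obtain ⟨h', hh', d, hxd⟩ := h₁ x x.2
  have e1 : (adZero (Fin n) k).toRepresentation g⁻¹ (f x) = f' ⟨h', hh'⟩ :=
    hkey ⟨h', hh'⟩ x x.2 d hxd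
  have e2 : f x = (adZero (Fin n) k).toRepresentation g (f' ⟨h', hh'⟩) := by
    rw [← e1, adGL_apply_inv_self]
  rw [e2, hm' ⟨h', hh'⟩, rep_ρ_apply, map_sub, adGL_eq_of_eq_scalar_mul_conj hxd,
    Module.End.mul_apply, Module.End.mul_apply, adGL_inv_apply_self]

/-- **Clause (3) transfers**: `W ↦ g⁻¹ W g` is an isomorphism between the lattices of
sub-`k[H]`-modules and sub-`k[H']`-modules of `ad⁰`, so a simple sub-`k[H]`-module `W` corresponds
to the simple sub-`k[H']`-module `g⁻¹ W g`; a regular semisimple `h' ∈ H'` fixing a non-zero vector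
of it yields the regular semisimple `c · g h' g⁻¹ ∈ H` fixing a non-zero vector of `W`.
[cite: ACCGHLNSTT2023, Def. 6.2.28 (remark: "only depends on the image of H in PGL_n(k)")] -/
theorem transfer_exists_isRegularSemisimple
    (h₁ : ∀ x ∈ H, ∃ h' ∈ H', ∃ c : kˣ, x = GeneralLinearGroup.scalar (Fin n) c * g * h' * g⁻¹)
    (h₂ : ∀ h' ∈ H', ∃ x ∈ H, ∃ c : kˣ, x = GeneralLinearGroup.scalar (Fin n) c * g * h' * g⁻¹)
    (hH' : Subgroup.IsEnormous H') (W : Subrepresentation (Subgroup.adZeroRep H)) (hW : IsAtom W) :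
    ∃ h : H, IsRegularSemisimple (h : GL (Fin n) k) ∧
      ∃ w ∈ W, w ≠ 0 ∧ Subgroup.adZeroRep H h w = w := by
  -- the lattice isomorphism `W ↦ g⁻¹ W g`
  let Φ : Subrepresentation (Subgroup.adZeroRep H) ≃o Subrepresentation (Subgroup.adZeroRep H') :=
    { toFun := fun W =>
        { toSubmodule := W.toSubmodule.map ((adZero (Fin n) k).toRepresentation g⁻¹)
          apply_mem_toSubmodule := fun h' v hv => by
            obtain ⟨w, hw, rfl⟩ := Submodule.mem_map.mp hv
            obtain ⟨x, hx, c, hxc⟩ := h₂ h' h'.2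
            refine Submodule.mem_map.mpr
              ⟨(adZero (Fin n) k).toRepresentation x w, W.apply_mem_toSubmodule ⟨x, hx⟩ hw, ?_⟩
            rw [adZeroRep_apply, adGL_eq_of_eq_scalar_mul_conj hxc, Module.End.mul_apply,
              Module.End.mul_apply, adGL_inv_apply_self] }
      invFun := fun W' =>
        { toSubmodule := W'.toSubmodule.map ((adZero (Fin n) k).toRepresentation g)
          apply_mem_toSubmodule := fun x v hv => by
            obtain ⟨w, hw, rfl⟩ := Submodule.mem_map.mp hv
            obtain ⟨h', hh', c, hxc⟩ := h₁ x x.2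
            refine Submodule.mem_map.mpr
              ⟨(adZero (Fin n) k).toRepresentation h' w, W'.apply_mem_toSubmodule ⟨h', hh'⟩ hw, ?_⟩
            rw [adZeroRep_apply, adGL_eq_of_eq_scalar_mul_conj hxc, Module.End.mul_apply,
              Module.End.mul_apply, adGL_inv_apply_self] }
      left_inv := fun W => by
        apply Subrepresentation.toSubmodule_injective
        change (W.toSubmodule.map ((adZero (Fin n) k).toRepresentation g⁻¹)).map
          ((adZero (Fin n) k).toRepresentation g) = W.toSubmodule
        rw [← Submodule.map_comp, ← Module.End.mul_eq_comp, ← map_mul, mul_inv_cancel, map_one,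
          Module.End.one_eq_id, Submodule.map_id]
      right_inv := fun W' => by
        apply Subrepresentation.toSubmodule_injective
        change (W'.toSubmodule.map ((adZero (Fin n) k).toRepresentation g)).map
          ((adZero (Fin n) k).toRepresentation g⁻¹) = W'.toSubmodule
        rw [← Submodule.map_comp, ← Module.End.mul_eq_comp, ← map_mul, inv_mul_cancel, map_one,
          Module.End.one_eq_id, Submodule.map_id]
      map_rel_iff' := by
        intro W₁ W₂
        change W₁.toSubmodule.map ((adZero (Fin n) k).toRepresentation g⁻¹) ≤
            W₂.toSubmodule.map ((adZero (Fin n) k).toRepresentation g⁻¹) ↔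
          W₁.toSubmodule ≤ W₂.toSubmodule
        refine Submodule.map_le_map_iff_of_injective (fun v w hvw => ?_) _ _
        have h := congrArg ((adZero (Fin n) k).toRepresentation g) hvw
        rwa [adGL_apply_inv_self, adGL_apply_inv_self] at h }
  have hW' : IsAtom (Φ W) := (OrderIso.isAtom_iff Φ W).mpr hW
  obtain ⟨h', hreg, w', hw'W, hw'0, hfix⟩ := hH'.exists_isRegularSemisimple _ hW'
  obtain ⟨x, hx, c, hxc⟩ := h₂ h' h'.2
  obtain ⟨w, hw, rfl⟩ :=
    (Submodule.mem_map :
      w' ∈ W.toSubmodule.map ((adZero (Fin n) k).toRepresentation g⁻¹) ↔ _).mp hw'W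
  refine ⟨⟨x, hx⟩, ?_, w, hw, ?_, ?_⟩
  · change IsRegularSemisimple x
    rw [hxc]
    exact isRegularSemisimple_scalar_mul_conj c g hreg
  · intro h0
    apply hw'0
    rw [h0, map_zero]
  · have h3 := congrArg ((adZero (Fin n) k).toRepresentation g) hfix
    rw [adGL_apply_inv_self] at h3
    change (adZero (Fin n) k).toRepresentation x w = w
    rw [adGL_eq_of_eq_scalar_mul_conj hxc, Module.End.mul_apply, Module.End.mul_apply]
    exact h3

/-- **"Enormous only depends on the image of `H` in `PGL_n(k)`"** (ACC+, remark after
Def. 6.2.28), in the form consumed by the line: let `k` have characteristic `p` with every unit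
of finite order prime to `p` (e.g. `k` algebraic over `𝔽_p`), and let `H, H' ≤ GL_n(k)`,
`g ∈ GL_n(k)` be such that `H` and `g H' g⁻¹` have the same image in `PGL_n(k)` — every `x ∈ H`
is `c · g h' g⁻¹` with `h' ∈ H'`, `c ∈ kˣ`, and every `h' ∈ H'` so arises.  If `H'` is enormous,
so is `H`.
[cite: ACCGHLNSTT2023, Def. 6.2.28 (remark: "only depends on the image of H in PGL_n(k)")] -/
theorem isEnormous_of_forall_exists_eq_scalar_mul_conj
    (htor : ∀ a : kˣ, ∃ m : ℕ, ¬ p ∣ m ∧ a ^ m = 1) (g : GL (Fin n) k)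
    {H H' : Subgroup (GL (Fin n) k)}
    (h₁ : ∀ x ∈ H, ∃ h' ∈ H', ∃ c : kˣ, x = GeneralLinearGroup.scalar (Fin n) c * g * h' * g⁻¹)
    (h₂ : ∀ h' ∈ H', ∃ x ∈ H, ∃ c : kˣ, x = GeneralLinearGroup.scalar (Fin n) c * g * h' * g⁻¹)
    (hH' : Subgroup.IsEnormous H') : Subgroup.IsEnormous H where
  eq_zero_of_card_quotient N _ a hN := transfer_card_quotient htor h₁ h₂ hH' N a hN
  invariants_eq_bot := transfer_invariants h₂ hH'
  cocycles₁_le_coboundaries₁ := transfer_cocycles₁ htor h₁ h₂ hH'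
  exists_isRegularSemisimple W hW := transfer_exists_isRegularSemisimple h₁ h₂ hH' W hW

/-- Lifting along equal projective images, first form: every `x ∈ A` is `c · y` with `y ∈ B`.
[folklore] -/
theorem exists_eq_scalar_mul_of_map_mk_eq {A B : Subgroup (GL (Fin n) k)}
    (hAB : A.map Matrix.ProjGenLinGroup.mk = B.map Matrix.ProjGenLinGroup.mk) :
    ∀ x ∈ A, ∃ y ∈ B, ∃ c : kˣ, x = GeneralLinearGroup.scalar (Fin n) c * 1 * y * 1⁻¹ := by
  intro x hx
  have hx' : Matrix.ProjGenLinGroup.mk x ∈ B.map Matrix.ProjGenLinGroup.mk :=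
    hAB ▸ Subgroup.mem_map_of_mem _ hx
  obtain ⟨y, hy, hyx⟩ := hx'
  obtain ⟨u, hu⟩ := Matrix.ProjGenLinGroup.mk_eq_mk_iff.mp hyx
  refine ⟨y, hy, u, ?_⟩
  rw [← hu, ← GeneralLinearGroup.scalar_commute, inv_one, mul_one, mul_one]

/-- Lifting along equal projective images, second form: over every `y ∈ B` lies some `c · y ∈ A`.
[folklore] -/
theorem exists_scalar_mul_mem_of_map_mk_eq {A B : Subgroup (GL (Fin n) k)}
    (hAB : A.map Matrix.ProjGenLinGroup.mk = B.map Matrix.ProjGenLinGroup.mk) :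
    ∀ y ∈ B, ∃ x ∈ A, ∃ c : kˣ, x = GeneralLinearGroup.scalar (Fin n) c * 1 * y * 1⁻¹ := by
  intro y hy
  have hy' : Matrix.ProjGenLinGroup.mk y ∈ A.map Matrix.ProjGenLinGroup.mk :=
    hAB.symm ▸ Subgroup.mem_map_of_mem _ hy
  obtain ⟨x, hx, hxy⟩ := hy'
  obtain ⟨u, hu⟩ := Matrix.ProjGenLinGroup.mk_eq_mk_iff.mp hxy
  refine ⟨x, hx, u⁻¹, ?_⟩
  rw [← hu, map_inv, inv_one, mul_one, mul_one, ← GeneralLinearGroup.scalar_commute, ← mul_assoc,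
    inv_mul_cancel, one_mul]

end Transfer

/-- **ACC+, remark after Def. 6.2.28, literal form: "this only depends on the image of `H` in
`PGL_n(k)`"** — if `H, H' ≤ GL_n(k)` have the same image in `PGL_n(k)` then `H` is enormous iff
`H'` is, for `k` of characteristic `p` whose units have finite order prime to `p` (e.g. `k`
algebraic over `𝔽_p`, ACC+'s standing assumption in §6.2.9).
[cite: ACCGHLNSTT2023, Def. 6.2.28 (remark: "only depends on the image of H in PGL_n(k)")] -/
theorem isEnormous_iff_of_map_mk_eq :
    ∀ {k : Type*} [Field k] {n p : ℕ} [Fact p.Prime] [CharP k p],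
      (∀ a : kˣ, ∃ m : ℕ, ¬ p ∣ m ∧ a ^ m = 1) →
      ∀ {H H' : Subgroup (GL (Fin n) k)},
        H.map Matrix.ProjGenLinGroup.mk = H'.map Matrix.ProjGenLinGroup.mk →
          (Subgroup.IsEnormous H ↔ Subgroup.IsEnormous H') := by
  intro k _ n p _ _ htor H H' h
  exact ⟨fun hH => isEnormous_of_forall_exists_eq_scalar_mul_conj htor 1
      (exists_eq_scalar_mul_of_map_mk_eq h.symm) (exists_scalar_mul_mem_of_map_mk_eq h.symm) hH,
    fun hH' => isEnormous_of_forall_exists_eq_scalar_mul_conj htor 1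
      (exists_eq_scalar_mul_of_map_mk_eq h) (exists_scalar_mul_mem_of_map_mk_eq h) hH'⟩


end Summit.Langlands.Langlands.Cruxes.AdjointLiftingGL3.Birth

end
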